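import Literature.Analysis.Fourier.HilbertTransformLineSplit
import Mathlib.Analysis.Calculus.ParametricIntegral
import Mathlib.Analysis.Calculus.ContDiff.Bounds
import HarnessLib

/-!
# The Hilbert transform on the line commutes with differentiation

Topic `Literature/Analysis/Fourier`. For the p.v. symmetric operator `hilbertTransform` of `HilbertTransformLine.lean`
(`Hf(x) = π⁻¹ ∫_{t>0} (f(x−t) − f(x+t))/t dt`) and `f ∈ C²(ℝ) ∩ L¹` with bounded second derivative and first derivative decaying like
`|f′(y)| ≤ C/(1 + y²)`, the Hilbert transform is differentiable with

  `(Hf)′(x) = H[f′](x)`    (`hasDerivAt_hilbertTransform`, `deriv_hilbertTransform`)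

[cite: King2009HilbertTransforms2, Appendix 1, Table 1.1, entry (1.20) (`H[f′] = (Hf)′`)]. Proof: differentiation under the integral sign
(`hasDerivAt_integral_of_dominated_loc_of_deriv_le`) with the dominating function `4M(1+t²)⁻¹ + 4C((1+(x₀−t)²)⁻¹ + (1+(x₀+t)²)⁻¹)` on `t > 0`:
near `t = 0` the difference quotient kernel `(f′(x−t) − f′(x+t))/t` is bounded by `2‖f″‖_∞` (mean value theorem), far out by the decay of `f′`
moved to the base point through `1 + (x₀ − t)² ≤ 4(1 + (x − t)²)` for `|x − x₀| ≤ 1`. This is the calculus rule used to generate closed forms of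
`H` on rational bases by differentiation (design input of the SHEET-ℝ certificate frame). No new definition.
-/

namespace Literature.Analysis.Fourier

open _root_.MeasureTheory Set Filter Metric
open scoped Real Topology

/-- Peetre-type inequality: `1 + (a + b)² ≤ 2(1 + a²)(1 + b²)` (helper). [folklore] -/
private theorem one_add_sq_add_le (a b : ℝ) : 1 + (a + b) ^ 2 ≤ 2 * (1 + a ^ 2) * (1 + b ^ 2) := by
  nlinarith [sq_nonneg (a - b), sq_nonneg (a * b), sq_nonneg a, sq_nonneg b]

/-- Moving the decay weight to the base point: for `|x − x₀| < 1`, `(1 + (x − t)²)⁻¹ ≤ 4·(1 + (x₀ − t)²)⁻¹` (helper). [folklore] -/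
private theorem inv_one_add_sq_shift_le {x x₀ : ℝ} (hx : dist x x₀ < 1) (t : ℝ) :
    (1 + (x - t) ^ 2)⁻¹ ≤ 4 * (1 + (x₀ - t) ^ 2)⁻¹ := by
  have hd : (x₀ - x) ^ 2 ≤ 1 := by
    rw [Real.dist_eq] at hx
    have : |x₀ - x| < 1 := by rw [abs_sub_comm]; exact hx
    nlinarith [abs_nonneg (x₀ - x), sq_abs (x₀ - x)]
  have h1 : 1 + (x₀ - t) ^ 2 ≤ 2 * (1 + (x - t) ^ 2) * (1 + (x₀ - x) ^ 2) := by
    have := one_add_sq_add_le (x - t) (x₀ - x)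
    rwa [show x - t + (x₀ - x) = x₀ - t by ring] at this
  have h2 : 1 + (x₀ - t) ^ 2 ≤ 4 * (1 + (x - t) ^ 2) := by nlinarith
  have hp : 0 < 1 + (x - t) ^ 2 := by positivity
  have hp0 : 0 < 1 + (x₀ - t) ^ 2 := by positivity
  rw [inv_eq_one_div, inv_eq_one_div, mul_one_div, div_le_div_iff₀ hp hp0]
  linarith

/-- **`(Hf)′ = H[f′]`** for `f ∈ C² ∩ L¹` with `|f″| ≤ M` and `|f′(y)| ≤ C/(1 + y²)`: the Hilbert transform is differentiable at every point,
with derivative the Hilbert transform of the derivative. [cite: King2009HilbertTransforms2, Appendix 1, Table 1.1, entry (1.20)] -/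
theorem hasDerivAt_hilbertTransform {f : ℝ → ℝ} {M C : ℝ} (hf : ContDiff ℝ 2 f) (hfi : Integrable f)
    (hM : ∀ y, |deriv (deriv f) y| ≤ M) (hC : ∀ y, |deriv f y| ≤ C / (1 + y ^ 2)) (x₀ : ℝ) :
    HasDerivAt (hilbertTransform f) (hilbertTransform (deriv f) x₀) x₀ := by
  -- regularity bookkeeping
  have hc : Continuous f := hf.continuous
  have hdiff : Differentiable ℝ f := hf.differentiable (by norm_num)
  have h1 : ContDiff ℝ 1 (deriv f) := (contDiff_succ_iff_deriv.1 (hf : ContDiff ℝ (1 + 1) f)).2.2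
  have hc' : Continuous (deriv f) := h1.continuous
  have hdiff' : Differentiable ℝ (deriv f) := h1.differentiable (by norm_num)
  have hM0 : 0 ≤ M := le_trans (abs_nonneg _) (hM 0)
  have hC0 : 0 ≤ C := by have := hC 0; simp at this; exact le_trans (abs_nonneg _) this
  -- the integrand and its `x`-derivative
  set F : ℝ → ℝ → ℝ := fun x t => (f (x - t) - f (x + t)) / t with hF_def
  set F' : ℝ → ℝ → ℝ := fun x t => (deriv f (x - t) - deriv f (x + t)) / t with hF'_def
  have hderF : ∀ t x, HasDerivAt (fun x => F x t) (F' x t) x := by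
    intro t x
    have ha : HasDerivAt (fun x => f (x - t)) (deriv f (x - t)) x := by
      simpa [Function.comp_def] using ((hdiff (x - t)).hasDerivAt).comp x ((hasDerivAt_id x).sub_const t)
    have hb : HasDerivAt (fun x => f (x + t)) (deriv f (x + t)) x := by
      simpa [Function.comp_def] using ((hdiff (x + t)).hasDerivAt).comp x ((hasDerivAt_id x).add_const t)
    exact (ha.sub hb).div_const t
  -- measurability
  have hmeas : ∀ x, AEStronglyMeasurable (F x) (volume.restrict (Ioi 0)) := fun x =>
    (((hc.comp (continuous_const.sub continuous_id)).sub (hc.comp (continuous_const.add continuous_id))).measurable.div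
      measurable_id).aestronglyMeasurable
  have hmeas' : AEStronglyMeasurable (F' x₀) (volume.restrict (Ioi 0)) :=
    (((hc'.comp (continuous_const.sub continuous_id)).sub (hc'.comp (continuous_const.add continuous_id))).measurable.div
      measurable_id).aestronglyMeasurable
  -- integrability of the symmetric integrand at the base point
  have hint : Integrable (F x₀) (volume.restrict (Ioi 0)) :=
    integrableOn_symmIntegrand_of_contDiff (hf.of_le (by norm_num)) hfi x₀
  -- the dominating function
  set bound : ℝ → ℝ := fun t => 4 * M * (1 + t ^ 2)⁻¹
      + 4 * C * ((1 + (x₀ - t) ^ 2)⁻¹ + (1 + (x₀ + t) ^ 2)⁻¹) with hbound_def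
  have hbound_int : Integrable bound (volume.restrict (Ioi 0)) := by
    refine Integrable.restrict ?_
    have h0 : Integrable fun t : ℝ => (1 + t ^ 2)⁻¹ := integrable_inv_one_add_sq
    have ha : Integrable fun t : ℝ => (1 + (x₀ - t) ^ 2)⁻¹ := h0.comp_sub_left x₀
    have hb : Integrable fun t : ℝ => (1 + (x₀ + t) ^ 2)⁻¹ := h0.comp_add_left x₀
    exact (h0.const_mul (4 * M)).add ((ha.add hb).const_mul (4 * C))
  -- pointwise domination on `t > 0`, uniformly for `x ∈ ball x₀ 1`
  have hdom : ∀ᵐ t ∂(volume.restrict (Ioi (0 : ℝ))), ∀ x ∈ ball x₀ 1, ‖F' x t‖ ≤ bound t := by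
    refine ae_restrict_of_forall_mem measurableSet_Ioi fun t ht x hx => ?_
    have ht0 : 0 < t := ht
    rw [Real.norm_eq_abs, hF'_def]
    simp only
    rw [abs_div, abs_of_pos ht0]
    -- (A) mean value bound: `|f′(x−t) − f′(x+t)| ≤ 2Mt`
    have hA : |deriv f (x - t) - deriv f (x + t)| ≤ M * (2 * t) := by
      have := Convex.norm_image_sub_le_of_norm_hasDerivWithin_le (f := deriv f) (f' := deriv (deriv f)) (s := univ)
        (fun z _ => ((hdiff' z).hasDerivAt).hasDerivWithinAt) (fun z _ => by rw [Real.norm_eq_abs]; exact hM z)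
        convex_univ (mem_univ (x + t)) (mem_univ (x - t))
      rw [Real.norm_eq_abs, Real.norm_eq_abs, show x - t - (x + t) = -(2 * t) by ring, abs_neg,
        abs_of_pos (show (0 : ℝ) < 2 * t by linarith)] at this
      exact this
    -- (B) decay bound moved to the base point
    have hB : |deriv f (x - t) - deriv f (x + t)| ≤
        4 * C * ((1 + (x₀ - t) ^ 2)⁻¹ + (1 + (x₀ + t) ^ 2)⁻¹) := by
      have h1 : |deriv f (x - t)| ≤ C * (4 * (1 + (x₀ - t) ^ 2)⁻¹) := by
        calc |deriv f (x - t)| ≤ C / (1 + (x - t) ^ 2) := hC _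
          _ = C * (1 + (x - t) ^ 2)⁻¹ := by rw [div_eq_mul_inv]
          _ ≤ C * (4 * (1 + (x₀ - t) ^ 2)⁻¹) :=
              mul_le_mul_of_nonneg_left (inv_one_add_sq_shift_le hx t) hC0
      have h2 : |deriv f (x + t)| ≤ C * (4 * (1 + (x₀ + t) ^ 2)⁻¹) := by
        have hx' : dist x x₀ < 1 := hx
        calc |deriv f (x + t)| ≤ C / (1 + (x + t) ^ 2) := hC _
          _ = C * (1 + (x - (-t)) ^ 2)⁻¹ := by rw [div_eq_mul_inv, sub_neg_eq_add]
          _ ≤ C * (4 * (1 + (x₀ - (-t)) ^ 2)⁻¹) :=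
              mul_le_mul_of_nonneg_left (inv_one_add_sq_shift_le hx' (-t)) hC0
          _ = C * (4 * (1 + (x₀ + t) ^ 2)⁻¹) := by rw [sub_neg_eq_add]
      calc |deriv f (x - t) - deriv f (x + t)| ≤ |deriv f (x - t)| + |deriv f (x + t)| := abs_sub _ _
        _ ≤ C * (4 * (1 + (x₀ - t) ^ 2)⁻¹) + C * (4 * (1 + (x₀ + t) ^ 2)⁻¹) := add_le_add h1 h2
        _ = 4 * C * ((1 + (x₀ - t) ^ 2)⁻¹ + (1 + (x₀ + t) ^ 2)⁻¹) := by ring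
    have hMpart : 0 ≤ 4 * M * (1 + t ^ 2)⁻¹ := by positivity
    have hCpart : 0 ≤ 4 * C * ((1 + (x₀ - t) ^ 2)⁻¹ + (1 + (x₀ + t) ^ 2)⁻¹) := by positivity
    rcases le_or_gt t 1 with ht1 | ht1
    · -- `t ≤ 1`: use (A): quotient ≤ 2M ≤ 4M/(1+t²)
      have hq : |deriv f (x - t) - deriv f (x + t)| / t ≤ 2 * M := by
        rw [div_le_iff₀ ht0]; linarith
      have h2M : 2 * M ≤ 4 * M * (1 + t ^ 2)⁻¹ := by
        have ht2 : 1 + t ^ 2 ≤ 2 := by nlinarith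
        have hpos : 0 < 1 + t ^ 2 := by positivity
        rw [← div_eq_mul_inv, le_div_iff₀ hpos]
        nlinarith
      rw [hbound_def]
      linarith
    · -- `t > 1`: use (B): quotient ≤ numerator
      have hq : |deriv f (x - t) - deriv f (x + t)| / t ≤ |deriv f (x - t) - deriv f (x + t)| := by
        rw [div_le_iff₀ ht0]
        have := abs_nonneg (deriv f (x - t) - deriv f (x + t))
        nlinarith
      rw [hbound_def]
      linarith
  have hdiff_ae : ∀ᵐ t ∂(volume.restrict (Ioi (0 : ℝ))), ∀ x ∈ ball x₀ 1, HasDerivAt (fun x => F x t) (F' x t) x :=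
    Eventually.of_forall fun t x _ => hderF t x
  have key := hasDerivAt_integral_of_dominated_loc_of_deriv_le (μ := volume.restrict (Ioi (0 : ℝ))) (x₀ := x₀)
    (F := F) (F' := F') (bound := bound) (ball_mem_nhds x₀ zero_lt_one) (Eventually.of_forall hmeas) hint hmeas'
    hdom hbound_int hdiff_ae
  -- assemble: `hilbertTransform f = π⁻¹ · ∫ F`
  have hfun : hilbertTransform f = fun x => π⁻¹ * ∫ t in Ioi (0 : ℝ), F x t := by
    funext x; rfl
  rw [hfun]
  have h2 := key.2.const_mul π⁻¹
  simpa [hilbertTransform, hF'_def] using h2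

/-- `deriv (Hf) = H(f′)` pointwise, under the hypotheses of `hasDerivAt_hilbertTransform`.
[cite: King2009HilbertTransforms2, Appendix 1, Table 1.1, entry (1.20)] -/
theorem deriv_hilbertTransform {f : ℝ → ℝ} {M C : ℝ} (hf : ContDiff ℝ 2 f) (hfi : Integrable f)
    (hM : ∀ y, |deriv (deriv f) y| ≤ M) (hC : ∀ y, |deriv f y| ≤ C / (1 + y ^ 2)) (x : ℝ) :
    deriv (hilbertTransform f) x = hilbertTransform (deriv f) x :=
  (hasDerivAt_hilbertTransform hf hfi hM hC x).deriv

/-- In particular `Hf` is differentiable under these hypotheses. [cite: King2009HilbertTransforms2, Appendix 1, Table 1.1, entry (1.20)] -/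
theorem differentiable_hilbertTransform {f : ℝ → ℝ} {M C : ℝ} (hf : ContDiff ℝ 2 f) (hfi : Integrable f)
    (hM : ∀ y, |deriv (deriv f) y| ≤ M) (hC : ∀ y, |deriv f y| ≤ C / (1 + y ^ 2)) :
    Differentiable ℝ (hilbertTransform f) := fun x =>
  (hasDerivAt_hilbertTransform hf hfi hM hC x).differentiableAt

end Literature.Analysis.Fourier
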